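import Literature.Probability.LatticeModels.FieldCurrents
import Literature.Probability.LatticeModels.GHSTruncatedPair
import HarnessLib

/-!
# The Ising system on `Λ ∪ {g}` with edge-dependent couplings: Gibbs side and random-current dictionary

Topic `Probability/LatticeModels`, namespace `Literature.Probability.LatticeModels`. Sequel of
`FieldCurrents` (currents on the edges `ℰ⁺_Λ` of the ghost graph `ghostGraph G Λ` with
edge-dependent couplings `θ : Sym2 (Option V) → ℝ`, generating sums `gcurrentZ`, the
high-temperature sums `ghteSum`). That file identifies the finite-volume *free* Ising state at
uniform coupling `β` and field `h` (`θ = ghostCoupling β (βh)`) with ratios of current sums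
(`isingCorr_free_eq_gcurrentZ_div`). The random-current arguments of Aizenman–Fernández 1986
(J. Stat. Phys. 44, 393–454, §§3–5: the derivation of the differential inequalities (1.15)–(1.16))
manipulate, besides the model itself, the systems "deprived of all the bonds in `C`"
(`⟨·⟩_{C^c}`, p. 411: "the coupling constants are set to zero for bonds not belonging to `A`"),
the model at zero field (`⟨·⟩_{h=0}`), and the "diluted" systems in which the couplings of a set of
bonds are multiplied by `s ∈ [0,1]` ((5.38)–(5.40)). All of these are the **same system with other
edge-dependent couplings `θ ≥ 0` on the same edge set**. This file sets up that system once: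

* `thetaCpl G Λ θ` — the couplings `θ` read as data for the tree's general ferromagnetic spin
  system `gksExpect` (Friedli–Velenik 2017, §3.8.1: `ν_{Λ;K} ∝ exp{∑_C K_C ω_C}` with `C` an edge
  inside `Λ` or a site of `Λ`), so that the GKS and GHS inequalities of `GKSInequalities` /
  `GHSInequality` and the coupling derivatives of `MagnetizationTransport` apply verbatim;
* `thetaExpect G Λ θ f`, `thetaCorr G Λ θ A = ⟨σ_A⟩_θ` — the state and its correlations;
* `gksWeight_thetaCpl` — its Boltzmann weight is `∏_{e ∈ ℰ⁺_Λ} exp(θ_e σ⁺_e)` (`σ_g = +1`);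
* `thetaCorr_ghostCoupling` / `isingExpect_free_eq_thetaExpect` — at `θ = ghostCoupling β (βh)` it
  is the tree's free state `⟨·⟩^∅_{Λ;β,h}`;
* `thetaCorr_eq_ghteSum_div`, `thetaCorr_eq_gcurrentZ_div` — **the random-current representation
  for general `θ ≥ 0`**: `⟨σ_A⟩_θ = Z_θ(A*)/Z_θ(∅)` on `ℰ⁺_Λ`, `A* = A` or `A ∪ {g}` by parity
  (Aizenman–Fernández 1986, (3.6)–(3.7): "the interaction with magnetic field can now be written
  as an Ising model with only pair interactions for which the spins at the `h`-sites are fixed at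
  the value `1`, and the coupling constants are `J_b = βJ_{xy}` for `b = {x,y}`, `= βh_x` for
  `b = {x, h_x}`"; Duminil-Copin–Tassion 2016, eq. (2.2));
* `thetaCorr_nonneg`, `thetaCorr_le_one`, `thetaCorr_mono` — Griffiths I/II in this language
  (couplings `0 ≤ θ ≤ θ'` give `⟨σ_A⟩_θ ≤ ⟨σ_A⟩_{θ'}`; in particular the depleted and zero-field
  systems are dominated by the full one, Aizenman–Fernández 1986, the uses of "Griffiths II" in
  §§4–5);
* the couplings with the bonds of `D` switched off are the tree's `cplOff θ D` (`LebowitzInequality`,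
  reused here with `ι = Sym2 (Option V)`); `gcurrentZ_cplOff` — its current sums are the current sums
  supported off `D`.

## References

* M. Aizenman, R. Fernández, *On the critical behavior of the magnetization in high-dimensional
  Ising models*, J. Stat. Phys. 44 (1986) 393–454, §3.2 (eqs. (3.6)–(3.7)), §3.3 (conventions
  after (3.10)) [AizenmanFernandezJSP1986] (held: `paper:url-b8cebc3f44bb`, author copy).
* H. Duminil-Copin, V. Tassion, CMP 343 (2016) 725, §2.3, eq. (2.2) (arXiv:1502.03050 numbering)
  [DuminilCopinTassionCMP2016].
* S. Friedli, Y. Velenik, *Statistical Mechanics of Lattice Systems*, CUP 2017, §3.8.1 (p. 141),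
  Thm. 3.49, Exercise 3.31 [FriedliVelenik2017].
-/

noncomputable section

open Finset MeasureTheory
open scoped symmDiff ENNReal

namespace Literature.Probability.LatticeModels

variable {V : Type*} [DecidableEq V]

section Theta

variable (G : SimpleGraph V) [G.LocallyFinite] (Λ : Finset V)

/-! ### The couplings `θ` as data for the general ferromagnetic spin system -/

/-- **The couplings of the `θ`-system** in the format of `gksExpect` (index set
`isingIdx G Λ = ℰ^b_Λ ⊕ Λ`): an edge `e` of `G` inside `Λ` carries `θ` of its lift to the ghost
graph, an edge leaving `Λ` carries `0` (free boundary condition), and the site `x` carries the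
coupling `θ_{x,g}` of its ghost edge (Aizenman–Fernández 1986, (3.7): `J_b = βJ_{xy}` on lattice
bonds, `βh_x` on the `h`-bonds). [cite: AizenmanFernandezJSP1986, §3.2, eq. (3.7)] -/
def thetaCpl (θ : Sym2 (Option V) → ℝ) : Sym2 V ⊕ V → ℝ
  | .inl e => if e ∈ edgesIn G Λ then θ (liftEdge e) else 0
  | .inr x => θ (ghostEdge x)

/-- **The `θ`-state** `⟨f⟩_θ` on `Λ`: the Gibbs expectation with weight
`exp(∑_{e ∈ ℰ_Λ} θ_e σ_xσ_y + ∑_{x ∈ Λ} θ_{x,g} σ_x)`, realised as the tree's `gksExpect` of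
`f ∘ glue` (configurations on `Λ` glued with the free boundary condition). [cite: AizenmanFernandezJSP1986, §3.2, eqs. (3.6)–(3.7)] -/
def thetaExpect (θ : Sym2 (Option V) → ℝ) (f : SpinConfig V → ℝ) : ℝ :=
  gksExpect (isingIdx G Λ) (thetaCpl G Λ θ) (isingSupp Λ) fun τ => f (glue Λ τ .free)

/-- The correlation `⟨σ_A⟩_θ` of the `θ`-state. [cite: AizenmanFernandezJSP1986, §3.2, eq. (3.6)] -/
def thetaCorr (θ : Sym2 (Option V) → ℝ) (A : Finset V) : ℝ :=
  thetaExpect G Λ θ (spinProduct A)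

variable {G Λ}

/-- The couplings are nonnegative when `θ` is. [folklore] -/
theorem thetaCpl_nonneg {θ : Sym2 (Option V) → ℝ} (hθ : ∀ e, 0 ≤ θ e) :
    ∀ i ∈ isingIdx G Λ, 0 ≤ thetaCpl G Λ θ i := by
  rintro (e | x) _
  · simp only [thetaCpl]
    split_ifs
    · exact hθ _
    · exact le_rfl
  · exact hθ _

/-- The couplings are nonnegative when `θ` is (unconditional form). [folklore] -/
theorem thetaCpl_nonneg' {θ : Sym2 (Option V) → ℝ} (hθ : ∀ e, 0 ≤ θ e) (i : Sym2 V ⊕ V) :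
    0 ≤ thetaCpl G Λ θ i := by
  rcases i with e | x
  · simp only [thetaCpl]
    split_ifs
    · exact hθ _
    · exact le_rfl
  · exact hθ _

/-- `cplOff` of nonnegative couplings is nonnegative. [folklore] -/
theorem cplOff_nonneg {θ : Sym2 (Option V) → ℝ} (hθ : ∀ e, 0 ≤ θ e) (D : Finset (Sym2 (Option V))) :
    ∀ e, 0 ≤ cplOff θ D e := by
  intro e
  unfold cplOff
  split_ifs
  · exact le_rfl
  · exact hθ e

/-- `cplOff θ D ≤ θ`. [folklore] -/
theorem cplOff_le {θ : Sym2 (Option V) → ℝ} (hθ : ∀ e, 0 ≤ θ e) (D : Finset (Sym2 (Option V))) :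
    ∀ e, cplOff θ D e ≤ θ e := by
  intro e
  unfold cplOff
  split_ifs
  · exact hθ e
  · exact le_rfl

/-- `cplOff θ D = 0` on `D`. [folklore] -/
theorem cplOff_of_mem {θ : Sym2 (Option V) → ℝ} {D : Finset (Sym2 (Option V))} {e : Sym2 (Option V)}
    (he : e ∈ D) : cplOff θ D e = 0 := by
  unfold cplOff; rw [if_pos he]

/-- `cplOff θ D = θ` off `D`. [folklore] -/
theorem cplOff_of_not_mem {θ : Sym2 (Option V) → ℝ} {D : Finset (Sym2 (Option V))} {e : Sym2 (Option V)}
    (he : e ∉ D) : cplOff θ D e = θ e := by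
  unfold cplOff; rw [if_neg he]

/-- Switching off monotonically: `cplOff θ D' ≤ cplOff θ D` for `D ⊆ D'`. [folklore] -/
theorem cplOff_anti {θ : Sym2 (Option V) → ℝ} (hθ : ∀ e, 0 ≤ θ e) {D D' : Finset (Sym2 (Option V))}
    (h : D ⊆ D') : ∀ e, cplOff θ D' e ≤ cplOff θ D e := by
  intro e
  unfold cplOff
  by_cases he : e ∈ D
  · rw [if_pos he, if_pos (h he)]
  · rw [if_neg he]
    split_ifs
    · exact hθ e
    · exact le_rfl

/-- Switching off twice: `cplOff (cplOff θ D) D' = cplOff θ (D ∪ D')`. [folklore] -/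
theorem cplOff_cplOff (θ : Sym2 (Option V) → ℝ) (D D' : Finset (Sym2 (Option V))) :
    cplOff (cplOff θ D) D' = cplOff θ (D ∪ D') := by
  funext e
  unfold cplOff
  by_cases h1 : e ∈ D' <;> by_cases h2 : e ∈ D <;> simp [h1, h2]

/-! ### The Boltzmann weight as a product over the edges of the ghost graph -/

/-- **The energy of the `θ`-system**: `∑ᵢ Kᵢ τ_{Cᵢ} = ∑_{e ∈ ℰ⁺_Λ} θ_e σ⁺_e` with the lifted
configuration `σ⁺ = liftSpin (glue τ)` (ghost spin `+1`; Aizenman–Fernández 1986, (3.6)–(3.7)). [cite: AizenmanFernandezJSP1986, §3.2, eqs. (3.6)–(3.7)] -/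
theorem gksHamiltonian_thetaCpl (θ : Sym2 (Option V) → ℝ) (τ : SpinConfig ↥Λ) :
    gksHamiltonian (isingIdx G Λ) (thetaCpl G Λ θ) (isingSupp Λ) τ =
      ∑ e ∈ edgesIn (ghostGraph G Λ) (Finset.insertNone Λ),
        θ e * bondSpin (liftSpin (glue Λ τ .free)) e := by
  rw [gksHamiltonian, isingIdx, Finset.sum_disjSum, sum_edgesIn_ghostGraph subset_rfl]
  congr 1
  · -- edge terms: only the edges inside `Λ` contribute
    have hE : ∑ e ∈ edgesTouching G Λ,
        thetaCpl G Λ θ (.inl e) * spinProduct (isingSupp Λ (.inl e)) τ =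
        ∑ e ∈ edgesIn G Λ, θ (liftEdge e) * spinProduct (isingSupp Λ (.inl e)) τ := by
      simp only [thetaCpl, ite_mul, zero_mul]
      rw [Finset.sum_ite_mem, Finset.inter_eq_right.2 (edgesIn_subset_edgesTouching (G := G) Λ)]
    rw [hE]
    refine sum_congr rfl fun e he => ?_
    have he' := mem_edgesIn_iff.1 he
    induction e using Sym2.ind with
    | _ x y =>
      have hxy : x ≠ y := G.ne_of_adj ((SimpleGraph.mem_edgeSet G).1 he'.1)
      rw [spinProduct_isingSupp_inl τ .free hxy, if_pos (he'.2 x (Sym2.mem_mk_left x y)),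
        if_pos (he'.2 y (Sym2.mem_mk_right x y)), liftEdge_mk, bondSpin_mk, spinAt_liftSpin_some,
        spinAt_liftSpin_some]
  · refine sum_congr rfl fun x hx => ?_
    simp only [thetaCpl]
    rw [spinProduct_isingSupp_inr τ .free hx, bondSpin_liftSpin_ghostEdge]

/-- **The Boltzmann weight of the `θ`-system is `∏_{e ∈ ℰ⁺_Λ} exp(θ_e σ⁺_e)`.** [cite: AizenmanFernandezJSP1986, §3.2, eqs. (3.6)–(3.7)] -/
theorem gksWeight_thetaCpl (θ : Sym2 (Option V) → ℝ) (τ : SpinConfig ↥Λ) :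
    gksWeight (isingIdx G Λ) (thetaCpl G Λ θ) (isingSupp Λ) τ =
      ∏ e ∈ edgesIn (ghostGraph G Λ) (Finset.insertNone Λ),
        Real.exp (θ e * bondSpin (liftSpin (glue Λ τ .free)) e) := by
  rw [gksWeight, gksHamiltonian_thetaCpl, Real.exp_sum]

/-- The weight of the `θ`-system is positive. [folklore] -/
theorem gksWeight_thetaCpl_pos (θ : Sym2 (Option V) → ℝ) (τ : SpinConfig ↥Λ) :
    0 < gksWeight (isingIdx G Λ) (thetaCpl G Λ θ) (isingSupp Λ) τ :=
  Real.exp_pos _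

/-- The normalising sum of the `θ`-system is positive. [folklore] -/
theorem gksSum_thetaCpl_one_pos (θ : Sym2 (Option V) → ℝ) :
    0 < gksSum (isingIdx G Λ) (thetaCpl G Λ θ) (isingSupp Λ) (fun _ => 1) := by
  unfold gksSum
  refine sum_pos (fun τ _ => ?_) univ_nonempty
  rw [one_mul]
  exact gksWeight_thetaCpl_pos θ τ

/-- `⟨f⟩_θ` as a ratio of finite sums. [folklore] -/
theorem thetaExpect_eq_sum_div (θ : Sym2 (Option V) → ℝ) (f : SpinConfig V → ℝ) :
    thetaExpect G Λ θ f =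
      (∑ τ : ↥Λ → ℤˣ, gksWeight (isingIdx G Λ) (thetaCpl G Λ θ) (isingSupp Λ) τ * f (glue Λ τ .free)) /
        ∑ τ : ↥Λ → ℤˣ, gksWeight (isingIdx G Λ) (thetaCpl G Λ θ) (isingSupp Λ) τ := by
  rw [thetaExpect, gksExpect, gksSum, gksSum]
  congr 1
  · exact sum_congr rfl fun τ _ => mul_comm _ _
  · exact sum_congr rfl fun τ _ => one_mul _

/-- `⟨1⟩_θ = 1`. [folklore] -/
theorem thetaExpect_one (θ : Sym2 (Option V) → ℝ) : thetaExpect G Λ θ (fun _ => 1) = 1 := by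
  rw [thetaExpect, gksExpect]
  exact div_self (gksSum_thetaCpl_one_pos θ).ne'

/-- `⟨σ_∅⟩_θ = 1`. [folklore] -/
theorem thetaCorr_empty (θ : Sym2 (Option V) → ℝ) : thetaCorr G Λ θ ∅ = 1 := by
  rw [thetaCorr]
  have : (spinProduct (∅ : Finset V) : SpinConfig V → ℝ) = fun _ => 1 := by
    funext σ; simp [spinProduct]
  rw [this, thetaExpect_one]

/-- Linearity of `⟨·⟩_θ`: sums. [folklore] -/
theorem thetaExpect_add (θ : Sym2 (Option V) → ℝ) (f g : SpinConfig V → ℝ) :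
    thetaExpect G Λ θ (fun σ => f σ + g σ) = thetaExpect G Λ θ f + thetaExpect G Λ θ g := by
  rw [thetaExpect_eq_sum_div, thetaExpect_eq_sum_div, thetaExpect_eq_sum_div, ← add_div, ← sum_add_distrib]
  congr 1
  exact sum_congr rfl fun τ _ => by ring

/-- Linearity of `⟨·⟩_θ`: differences. [folklore] -/
theorem thetaExpect_sub (θ : Sym2 (Option V) → ℝ) (f g : SpinConfig V → ℝ) :
    thetaExpect G Λ θ (fun σ => f σ - g σ) = thetaExpect G Λ θ f - thetaExpect G Λ θ g := by
  rw [thetaExpect_eq_sum_div, thetaExpect_eq_sum_div, thetaExpect_eq_sum_div, ← sub_div, ← sum_sub_distrib]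
  congr 1
  exact sum_congr rfl fun τ _ => by ring

/-- Linearity of `⟨·⟩_θ`: scalars. [folklore] -/
theorem thetaExpect_const_mul (θ : Sym2 (Option V) → ℝ) (c : ℝ) (f : SpinConfig V → ℝ) :
    thetaExpect G Λ θ (fun σ => c * f σ) = c * thetaExpect G Λ θ f := by
  rw [thetaExpect_eq_sum_div, thetaExpect_eq_sum_div, mul_div_assoc', mul_sum]
  congr 1
  exact sum_congr rfl fun τ _ => by ring

/-- Linearity of `⟨·⟩_θ`: finite sums. [folklore] -/
theorem thetaExpect_finset_sum {ι : Type*} (θ : Sym2 (Option V) → ℝ) (s : Finset ι) (f : ι → SpinConfig V → ℝ) :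
    thetaExpect G Λ θ (fun σ => ∑ i ∈ s, f i σ) = ∑ i ∈ s, thetaExpect G Λ θ (f i) := by
  classical
  induction s using Finset.induction_on with
  | empty =>
    simp only [sum_empty]
    rw [thetaExpect_eq_sum_div]
    simp
  | insert i s hi ih =>
    simp only [sum_insert hi]
    rw [thetaExpect_add, ih]

/-- `⟨σ_A⟩_θ` in the subtype form of the `gksExpect` framework, for `A ⊆ Λ`. [folklore] -/
theorem thetaCorr_eq_gksExpect {θ : Sym2 (Option V) → ℝ} {A : Finset V} (hA : A ⊆ Λ) :
    thetaCorr G Λ θ A =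
      gksExpect (isingIdx G Λ) (thetaCpl G Λ θ) (isingSupp Λ) (spinProduct (inVol Λ A)) := by
  rw [thetaCorr, thetaExpect]
  congr 1
  funext τ
  exact spinProduct_glue_of_subset hA τ .free

/-! ### The uniform-coupling case: the tree's free state -/

/-- At `θ = ghostCoupling β (βh)` the couplings are those of the tree's free-boundary Ising model
(`gksCoupling G Λ β h .free`). [cite: FriedliVelenik2017, §3.8.1, p. 141] -/
theorem thetaCpl_ghostCoupling (β h : ℝ) :
    thetaCpl G Λ (ghostCoupling β (β * h)) = gksCoupling G Λ β h .free := by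
  funext i
  rcases i with e | x
  · simp only [thetaCpl, gksCoupling, interactionEdges_free, ghostCoupling_liftEdge]
    split_ifs with he
    · rw [edgeCoeff_of_mem_edgesIn G _ he, mul_one]
    · rfl
  · simp only [thetaCpl, gksCoupling, ghostCoupling_ghostEdge]

/-- **The `θ`-state at uniform couplings is the free Ising state**:
`⟨f⟩_{ghostCoupling β (βh)} = ⟨f⟩^∅_{Λ;β,h}` for measurable `f`. [cite: FriedliVelenik2017, §3.8.1, p. 141] -/
theorem isingExpect_free_eq_thetaExpect (β h : ℝ) {f : SpinConfig V → ℝ} (hf : Measurable f) :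
    isingExpect G Λ β h .free f = thetaExpect G Λ (ghostCoupling β (β * h)) f := by
  rw [isingExpect, integral_isingMeasure G Λ β h .free hf, thetaExpect_eq_sum_div, thetaCpl_ghostCoupling,
    isingPartitionFunction]
  congr 1
  · exact sum_congr rfl fun τ _ => by rw [isingWeight_eq_gksWeight]
  · exact sum_congr rfl fun τ _ => by rw [isingWeight_eq_gksWeight]

/-- **Correlations at uniform couplings**: `⟨σ_A⟩_{ghostCoupling β (βh)} = ⟨σ_A⟩^∅_{Λ;β,h}`. [cite: FriedliVelenik2017, §3.8.1, p. 141] -/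
theorem thetaCorr_ghostCoupling (β h : ℝ) (A : Finset V) :
    thetaCorr G Λ (ghostCoupling β (β * h)) A = isingCorr G Λ β h .free A := by
  rw [thetaCorr, isingCorr, isingExpect_free_eq_thetaExpect β h (measurable_spinProduct A)]

/-! ### The high-temperature expansion and the random-current representation for general `θ` -/

/-- **High-temperature expansion of the weight**:
`∏_{ℰ⁺_Λ} e^{θ_e σ⁺_e} = ∑_{F ⊆ ℰ⁺_Λ} (∏_F sinh θ)(∏_{ℰ⁺_Λ∖F} cosh θ) σ_{∂F ∖ {g}}`
(Aizenman–Fernández 1986, (3.2)–(3.4) in the `tanh` form; Duminil-Copin 2016, §2.2.1). [cite: AizenmanFernandezJSP1986, §3.2, eqs. (3.2)–(3.6)] -/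
theorem gksWeight_thetaCpl_eq_sum (θ : Sym2 (Option V) → ℝ) (τ : SpinConfig ↥Λ) :
    gksWeight (isingIdx G Λ) (thetaCpl G Λ θ) (isingSupp Λ) τ =
      ∑ F ∈ (edgesIn (ghostGraph G Λ) (Finset.insertNone Λ)).powerset,
        ((∏ e ∈ F, Real.sinh (θ e)) *
            ∏ e ∈ edgesIn (ghostGraph G Λ) (Finset.insertNone Λ) \ F, Real.cosh (θ e)) *
          spinProduct (Finset.eraseNone (oddVerts (Finset.insertNone Λ) F)) (glue Λ τ .free) := by
  rw [gksWeight_thetaCpl]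
  simp_rw [exp_mul_bondSpin, add_comm (Real.cosh _)]
  rw [prod_add]
  refine sum_congr rfl fun F hF => ?_
  rw [prod_mul_distrib, prod_bondSpin_eq_spinProduct_oddVerts (ghostGraph G Λ) (mem_powerset.1 hF),
    spinProduct_liftSpin]
  ring

/-- **High-temperature expansion of the Boltzmann sums of the `θ`-system**: for `A ⊆ Λ`,
`∑_τ w_θ(τ) σ_A(τ) = 2^{|Λ|} ∑_{F ⊆ ℰ⁺_Λ, ∂F = A*} (∏_F sinh θ)(∏_{ℰ⁺_Λ∖F} cosh θ)`
(Aizenman–Fernández 1986, (3.4)–(3.6): "the trace is zero unless all the spin functions have an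
even exponent"). [cite: AizenmanFernandezJSP1986, §3.2, eqs. (3.4)–(3.6)] -/
theorem sum_gksWeight_thetaCpl_mul_spinProduct (θ : Sym2 (Option V) → ℝ) {A : Finset V} (hA : A ⊆ Λ) :
    ∑ τ : ↥Λ → ℤˣ, gksWeight (isingIdx G Λ) (thetaCpl G Λ θ) (isingSupp Λ) τ * spinProduct A (glue Λ τ .free) =
      Fintype.card (↥Λ → ℤˣ) *
        ∑ F ∈ (edgesIn (ghostGraph G Λ) (Finset.insertNone Λ)).powerset with
            oddVerts (Finset.insertNone Λ) F = starSet A,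
          (∏ e ∈ F, Real.sinh (θ e)) *
            ∏ e ∈ edgesIn (ghostGraph G Λ) (Finset.insertNone Λ) \ F, Real.cosh (θ e) := by
  set E := edgesIn (ghostGraph G Λ) (Finset.insertNone Λ) with hE
  set c : Finset (Sym2 (Option V)) → ℝ := fun F =>
    (∏ e ∈ F, Real.sinh (θ e)) * ∏ e ∈ E \ F, Real.cosh (θ e) with hc
  have hOsub : ∀ F ∈ E.powerset, Finset.eraseNone (oddVerts (Finset.insertNone Λ) F) ⊆ Λ := by
    intro F _ x hx
    rw [Finset.mem_eraseNone] at hx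
    exact Finset.some_mem_insertNone.1 (oddVerts_subset _ _ hx)
  calc ∑ τ : ↥Λ → ℤˣ, gksWeight (isingIdx G Λ) (thetaCpl G Λ θ) (isingSupp Λ) τ * spinProduct A (glue Λ τ .free)
      = ∑ τ : ↥Λ → ℤˣ, ∑ F ∈ E.powerset,
          c F * spinProduct (Finset.eraseNone (oddVerts (Finset.insertNone Λ) F) ∆ A) (glue Λ τ .free) := by
        refine sum_congr rfl fun τ _ => ?_
        rw [gksWeight_thetaCpl_eq_sum, sum_mul]
        refine sum_congr rfl fun F _ => ?_
        rw [mul_assoc, spinProduct_mul_spinProduct]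
    _ = ∑ F ∈ E.powerset, c F *
          if Finset.eraseNone (oddVerts (Finset.insertNone Λ) F) ∆ A = ∅ then (Fintype.card (↥Λ → ℤˣ) : ℝ) else 0 := by
        rw [sum_comm]
        refine sum_congr rfl fun F hF => ?_
        rw [← mul_sum, sum_spinProduct_glue (symmDiff_le_sup.trans (sup_le (hOsub F hF) hA))]
    _ = ∑ F ∈ E.powerset with oddVerts (Finset.insertNone Λ) F = starSet A, c F * Fintype.card (↥Λ → ℤˣ) := by
        rw [sum_filter]
        refine sum_congr rfl fun F hF => ?_
        have heven : Even #(oddVerts (Finset.insertNone Λ) F) := even_card_oddVerts (mem_powerset.1 hF)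
        by_cases hq : oddVerts (Finset.insertNone Λ) F = starSet A
        · rw [if_pos hq, if_pos]
          rw [Finset.symmDiff_eq_empty, (eraseNone_eq_iff_eq_starSet heven A).2 hq]
        · rw [if_neg hq, if_neg, mul_zero]
          intro h0
          exact hq ((eraseNone_eq_iff_eq_starSet heven A).1 (Finset.symmDiff_eq_empty.1 h0))
    _ = _ := by
        rw [mul_sum]
        exact sum_congr rfl fun F _ => by simp only [hc]; ring

/-- **`⟨σ_A⟩_θ` by the high-temperature expansion**: `⟨σ_A⟩_θ = g(A*)/g(∅)`,
`g(B) = ∑_{F ⊆ ℰ⁺_Λ, ∂F = B} ∏_F tanh θ_e`, for `A ⊆ Λ`. [cite: AizenmanFernandezJSP1986, §3.2, eq. (3.6)] -/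
theorem thetaCorr_eq_ghteSum_div (θ : Sym2 (Option V) → ℝ) {A : Finset V} (hA : A ⊆ Λ) :
    thetaCorr G Λ θ A =
      ghteSum (Finset.insertNone Λ) θ (edgesIn (ghostGraph G Λ) (Finset.insertNone Λ)) (starSet A) /
        ghteSum (Finset.insertNone Λ) θ (edgesIn (ghostGraph G Λ) (Finset.insertNone Λ)) ∅ := by
  have h1 : ∑ τ : ↥Λ → ℤˣ, gksWeight (isingIdx G Λ) (thetaCpl G Λ θ) (isingSupp Λ) τ =
      ∑ τ : ↥Λ → ℤˣ, gksWeight (isingIdx G Λ) (thetaCpl G Λ θ) (isingSupp Λ) τ * spinProduct ∅ (glue Λ τ .free) := by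
    simp [spinProduct]
  rw [thetaCorr, thetaExpect_eq_sum_div, h1, sum_gksWeight_thetaCpl_mul_spinProduct θ hA,
    sum_gksWeight_thetaCpl_mul_spinProduct θ (empty_subset Λ), sum_sinh_cosh_eq_cosh_mul_ghteSum,
    sum_sinh_cosh_eq_cosh_mul_ghteSum, starSet_empty]
  have hc : (Fintype.card (↥Λ → ℤˣ) : ℝ) *
      ∏ e ∈ edgesIn (ghostGraph G Λ) (Finset.insertNone Λ), Real.cosh (θ e) ≠ 0 :=
    (mul_pos (Nat.cast_pos.2 Fintype.card_pos) (prod_pos fun e _ => Real.cosh_pos _)).ne'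
  rw [← mul_assoc, ← mul_assoc, mul_div_mul_left _ _ hc]

/-- **The random-current representation of the `θ`-state** (Aizenman–Fernández 1986, (3.6) with
the conventions (3.7); Duminil-Copin–Tassion 2016, eq. (2.2)): for `θ ≥ 0` and `A ⊆ Λ`,
`⟨σ_A⟩_θ = Z_θ(A*)/Z_θ(∅)`, the currents living on `ℰ⁺_Λ`, `A* = A` or `A ∪ {g}` by parity. [cite: AizenmanFernandezJSP1986, §3.2, eqs. (3.6)–(3.7)] -/
theorem thetaCorr_eq_gcurrentZ_div {θ : Sym2 (Option V) → ℝ} (hθ : ∀ e, 0 ≤ θ e) {A : Finset V} (hA : A ⊆ Λ) :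
    thetaCorr G Λ θ A =
      (gcurrentZ (ghostGraph G Λ) (Finset.insertNone Λ) θ (edgesIn (ghostGraph G Λ) (Finset.insertNone Λ))
          (starSet A)).toReal /
        (gcurrentZ (ghostGraph G Λ) (Finset.insertNone Λ) θ (edgesIn (ghostGraph G Λ) (Finset.insertNone Λ))
          ∅).toReal := by
  rw [toReal_gcurrentZ_ghost subset_rfl hθ subset_rfl, toReal_gcurrentZ_ghost subset_rfl hθ subset_rfl,
    thetaCorr_eq_ghteSum_div θ hA, mul_div_mul_left _ _ (prod_pos fun e _ => Real.cosh_pos _).ne']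

/-! ### Griffiths' inequalities for the `θ`-system -/

/-- **GKS I**: `⟨σ_A⟩_θ ≥ 0` for `θ ≥ 0`, `A ⊆ Λ`. [cite: FriedliVelenik2017, Thm. 3.49, eq. (3.55)] -/
theorem thetaCorr_nonneg {θ : Sym2 (Option V) → ℝ} (hθ : ∀ e, 0 ≤ θ e) {A : Finset V} (hA : A ⊆ Λ) :
    0 ≤ thetaCorr G Λ θ A := by
  rw [thetaCorr_eq_gksExpect hA]
  exact gksExpect_spinProduct_nonneg _ _ _ (thetaCpl_nonneg hθ) _

/-- `⟨σ_A⟩_θ ≤ 1`. [folklore] -/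
theorem thetaCorr_le_one (θ : Sym2 (Option V) → ℝ) (A : Finset V) : thetaCorr G Λ θ A ≤ 1 := by
  rw [thetaCorr, thetaExpect_eq_sum_div, div_le_one (by
    refine sum_pos (fun τ _ => gksWeight_thetaCpl_pos θ τ) univ_nonempty)]
  refine sum_le_sum fun τ _ => ?_
  have h1 : spinProduct A (glue Λ τ .free) ≤ 1 := by
    rcases spinProduct_eq_one_or A (glue Λ τ .free) with h | h
    · rw [h]
    · rw [h]; norm_num
  calc gksWeight (isingIdx G Λ) (thetaCpl G Λ θ) (isingSupp Λ) τ * spinProduct A (glue Λ τ .free)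
      ≤ gksWeight (isingIdx G Λ) (thetaCpl G Λ θ) (isingSupp Λ) τ * 1 :=
        mul_le_mul_of_nonneg_left h1 (gksWeight_thetaCpl_pos θ τ).le
    _ = _ := mul_one _

/-- `|⟨σ_A⟩_θ| ≤ 1`. [folklore] -/
theorem abs_thetaCorr_le_one (θ : Sym2 (Option V) → ℝ) (A : Finset V) : |thetaCorr G Λ θ A| ≤ 1 := by
  rw [thetaCorr, thetaExpect_eq_sum_div, abs_div,
    abs_of_pos (sum_pos (fun τ _ => gksWeight_thetaCpl_pos θ τ) univ_nonempty),
    div_le_one (sum_pos (fun τ _ => gksWeight_thetaCpl_pos θ τ) univ_nonempty)]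
  refine (abs_sum_le_sum_abs _ _).trans (sum_le_sum fun τ _ => ?_)
  rw [abs_mul, abs_of_pos (gksWeight_thetaCpl_pos θ τ)]
  have h1 : |spinProduct A (glue Λ τ .free)| = 1 := abs_spinProduct A _
  rw [h1, mul_one]

/-- **GKS II, comparison of couplings**: `0 ≤ θ ≤ θ'` gives `⟨σ_A⟩_θ ≤ ⟨σ_A⟩_{θ'}` (`A ⊆ Λ`). In
particular the systems with bonds switched off and the zero-field system are dominated by the full
system (the uses of "Griffiths II" in Aizenman–Fernández 1986, §§4–5). [cite: FriedliVelenik2017, Exercise 3.31, p. 142] -/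
theorem thetaCorr_mono {θ θ' : Sym2 (Option V) → ℝ} (hθ : ∀ e, 0 ≤ θ e) (hle : ∀ e, θ e ≤ θ' e)
    {A : Finset V} (hA : A ⊆ Λ) : thetaCorr G Λ θ A ≤ thetaCorr G Λ θ' A := by
  rw [thetaCorr_eq_gksExpect hA, thetaCorr_eq_gksExpect hA]
  refine gksExpect_mono_of_abs_le _ _ (fun i _ => ?_) _
  rcases i with e | x
  · simp only [thetaCpl]
    split_ifs
    · rw [abs_of_nonneg (hθ _)]; exact hle _
    · simp
  · simp only [thetaCpl]
    rw [abs_of_nonneg (hθ _)]; exact hle _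

/-- Switching off bonds lowers correlations: `⟨σ_A⟩_{θ 𝟙_{Dᶜ}} ≤ ⟨σ_A⟩_θ`. [cite: AizenmanFernandezJSP1986, §4.2, proof of (e), "by the Griffiths (II) inequality"] -/
theorem thetaCorr_cplOff_le {θ : Sym2 (Option V) → ℝ} (hθ : ∀ e, 0 ≤ θ e) (D : Finset (Sym2 (Option V)))
    {A : Finset V} (hA : A ⊆ Λ) : thetaCorr G Λ (cplOff θ D) A ≤ thetaCorr G Λ θ A :=
  thetaCorr_mono (cplOff_nonneg hθ D) (cplOff_le hθ D) hA

/-- Switching off more bonds lowers correlations more: `D ⊆ D'` gives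
`⟨σ_A⟩_{θ 𝟙_{D'ᶜ}} ≤ ⟨σ_A⟩_{θ 𝟙_{Dᶜ}}` (Aizenman–Fernández 1986, (5.37)). [cite: AizenmanFernandezJSP1986, §5.2, eq. (5.37)] -/
theorem thetaCorr_cplOff_anti {θ : Sym2 (Option V) → ℝ} (hθ : ∀ e, 0 ≤ θ e) {D D' : Finset (Sym2 (Option V))}
    (h : D ⊆ D') {A : Finset V} (hA : A ⊆ Λ) :
    thetaCorr G Λ (cplOff θ D') A ≤ thetaCorr G Λ (cplOff θ D) A :=
  thetaCorr_mono (cplOff_nonneg hθ D') (cplOff_anti hθ h) hA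

/-- **GKS II, products**: `⟨σ_A σ_B⟩_θ ≥ ⟨σ_A⟩_θ ⟨σ_B⟩_θ`, i.e. `⟨σ_{A ∆ B}⟩ ≥ ⟨σ_A⟩⟨σ_B⟩`
(`A, B ⊆ Λ`, `θ ≥ 0`). [cite: FriedliVelenik2017, Thm. 3.49, eq. (3.56)] -/
theorem thetaCorr_mul_le_symmDiff {θ : Sym2 (Option V) → ℝ} (hθ : ∀ e, 0 ≤ θ e) {A B : Finset V}
    (hA : A ⊆ Λ) (hB : B ⊆ Λ) :
    thetaCorr G Λ θ A * thetaCorr G Λ θ B ≤ thetaCorr G Λ θ (A ∆ B) := by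
  rw [thetaCorr_eq_gksExpect hA, thetaCorr_eq_gksExpect hB,
    thetaCorr_eq_gksExpect (symmDiff_le_sup.trans (sup_le hA hB)), inVol_symmDiff]
  exact gksExpect_mul_gksExpect_le _ _ _ (thetaCpl_nonneg hθ) (inVol Λ A) (inVol Λ B)

/-! ### Current sums with bonds switched off -/

/-- The current sums of `θ 𝟙_{Dᶜ}` on an edge set `E'` are the current sums of `θ` on `E' ∖ D`. [cite: AizenmanFernandezJSP1986, §3.3, conventions after eq. (3.10)] -/
theorem gcurrentZ_cplOff (θ : Sym2 (Option V) → ℝ) (E' D : Finset (Sym2 (Option V))) (X : Finset (Option V)) :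
    gcurrentZ (ghostGraph G Λ) (Finset.insertNone Λ) (cplOff θ D) E' X =
      gcurrentZ (ghostGraph G Λ) (Finset.insertNone Λ) θ (E' \ D) X := by
  rw [gcurrentZ_eq_of_zero_off (sdiff_subset (s := E') (t := D))]
  · refine gcurrentZ_congr (fun e he => ?_) X
    exact cplOff_of_not_mem (mem_sdiff.1 he).2
  · intro e _ hne
    have : e ∈ D := by
      by_contra h
      exact hne (mem_sdiff.2 ⟨‹e ∈ E'›, h⟩)
    exact cplOff_of_mem this

/-- **Depleted correlations as current sums inside the retained region** (Aizenman–Fernández 1986,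
Lemma 3.2 and the conventions after (3.10): `⟨σ_B⟩_{C(p)^c}` is computed from "the current
configurations … outside the cluster"): for `S ⊆ Λ ∪ {g}` and `A ⊆ Λ`, switching off every bond
not inside `S` gives `⟨σ_A⟩ = Z_θ(ℰ_S; A*)/Z_θ(ℰ_S; ∅)` with the currents on the edges of the
ghost graph inside `S` only (both sides vanish unless `A* ⊆ S`; if `g ∉ S` this is a zero-field
system). [cite: AizenmanFernandezJSP1986, §3.3, Lemma 3.2, eq. (3.10)] -/
theorem thetaCorr_cplOff_eq_gcurrentZ_div {θ : Sym2 (Option V) → ℝ} (hθ : ∀ e, 0 ≤ θ e)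
    {S : Finset (Option V)} (hS : S ⊆ Finset.insertNone Λ) {A : Finset V} (hA : A ⊆ Λ) :
    thetaCorr G Λ (cplOff θ (edgesIn (ghostGraph G Λ) (Finset.insertNone Λ) \ edgesIn (ghostGraph G Λ) S)) A =
      (gcurrentZ (ghostGraph G Λ) (Finset.insertNone Λ) θ (edgesIn (ghostGraph G Λ) S) (starSet A)).toReal /
        (gcurrentZ (ghostGraph G Λ) (Finset.insertNone Λ) θ (edgesIn (ghostGraph G Λ) S) ∅).toReal := by
  have hsub : edgesIn (ghostGraph G Λ) S ⊆ edgesIn (ghostGraph G Λ) (Finset.insertNone Λ) :=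
    edgesIn_mono (ghostGraph G Λ) hS
  rw [thetaCorr_eq_gcurrentZ_div (cplOff_nonneg hθ _) hA, gcurrentZ_cplOff, gcurrentZ_cplOff,
    Finset.sdiff_sdiff_eq_self hsub]

/-! ### The zero-field system and the GHS domination of the truncated pair function -/

variable (G Λ) in
/-- **The couplings at zero field**: `θ` with every ghost edge switched off (Aizenman–Fernández
1986, the subscript `h = 0`, e.g. in (4.22): "`⟨σ_xσ_y⟩_{h=0}`", the model "at `h = 0` and the
given value of `β`"). [cite: AizenmanFernandezJSP1986, §4.3, Prop. 4.7, eq. (4.22)] -/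
def zeroField (θ : Sym2 (Option V) → ℝ) : Sym2 (Option V) → ℝ :=
  fun e => if (none : Option V) ∈ e then 0 else θ e

/-- Lattice edges keep their coupling at zero field. [folklore] -/
@[simp] theorem zeroField_liftEdge (θ : Sym2 (Option V) → ℝ) (e : Sym2 V) :
    zeroField θ (liftEdge e) = θ (liftEdge e) := by
  rw [zeroField, if_neg (none_not_mem_liftEdge e)]

/-- Ghost edges carry no coupling at zero field. [folklore] -/
@[simp] theorem zeroField_ghostEdge (θ : Sym2 (Option V) → ℝ) (x : V) : zeroField θ (ghostEdge x) = 0 := by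
  rw [zeroField, if_pos (none_mem_ghostEdge x)]

/-- `zeroField θ ≥ 0` for `θ ≥ 0`. [folklore] -/
theorem zeroField_nonneg {θ : Sym2 (Option V) → ℝ} (hθ : ∀ e, 0 ≤ θ e) : ∀ e, 0 ≤ zeroField θ e := by
  intro e; unfold zeroField; split_ifs
  · exact le_rfl
  · exact hθ e

/-- `zeroField θ ≤ θ` for `θ ≥ 0`. [folklore] -/
theorem zeroField_le {θ : Sym2 (Option V) → ℝ} (hθ : ∀ e, 0 ≤ θ e) : ∀ e, zeroField θ e ≤ θ e := by
  intro e; unfold zeroField; split_ifs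
  · exact hθ e
  · exact le_rfl

/-- The `gksExpect` couplings at zero field: unchanged on edges, `0` on sites. [folklore] -/
theorem thetaCpl_zeroField (θ : Sym2 (Option V) → ℝ) (i : Sym2 V ⊕ V) :
    thetaCpl G Λ (zeroField θ) i = Sum.elim (fun e => thetaCpl G Λ θ (.inl e)) (fun _ => 0) i := by
  rcases i with e | x
  · simp only [thetaCpl, zeroField_liftEdge, Sum.elim_inl]
  · simp only [thetaCpl, zeroField_ghostEdge, Sum.elim_inr]

/-- `⟨σ_x⟩_θ` in `gksExpect` form (`x ∈ Λ`). [folklore] -/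
theorem thetaCorr_singleton_eq_gksExpect (θ : Sym2 (Option V) → ℝ) {x : V} (hx : x ∈ Λ) :
    thetaCorr G Λ θ {x} = gksExpect (isingIdx G Λ) (thetaCpl G Λ θ) (isingSupp Λ) (spinAt ⟨x, hx⟩) := by
  rw [thetaCorr, thetaExpect]
  congr 1
  funext τ
  rw [spinProduct_singleton, spinAt_glue_of_mem τ .free hx]

/-- `⟨σ_xσ_y⟩_θ = ⟨σ_{{x} ∆ {y}}⟩_θ` in `gksExpect` form (`x, y ∈ Λ`). [folklore] -/
theorem thetaCorr_pair_eq_gksExpect (θ : Sym2 (Option V) → ℝ) {x y : V} (hx : x ∈ Λ) (hy : y ∈ Λ) :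
    thetaCorr G Λ θ ({x} ∆ {y}) =
      gksExpect (isingIdx G Λ) (thetaCpl G Λ θ) (isingSupp Λ) (fun τ => spinAt ⟨x, hx⟩ τ * spinAt ⟨y, hy⟩ τ) := by
  rw [thetaCorr, thetaExpect]
  congr 1
  funext τ
  rw [← spinProduct_mul_spinProduct, spinProduct_singleton, spinProduct_singleton,
    spinAt_glue_of_mem τ .free hx, spinAt_glue_of_mem τ .free hy]

/-- **GHS domination of the truncated pair function by the zero-field pair function**
(Aizenman–Fernández 1986, the right inequality of (4.22), `⟨σ_x;σ_y⟩ ≤ K(x,y) ≤ ⟨σ_xσ_y⟩_{h=0}`,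
here in the weaker form `⟨σ_x;σ_y⟩ ≤ ⟨σ_xσ_y⟩_{h=0}` which is what is used in (5.8), (5.26) and
(5.51)): for `θ ≥ 0` and `x, y ∈ Λ`,
`⟨σ_xσ_y⟩_θ - ⟨σ_x⟩_θ⟨σ_y⟩_θ ≤ ⟨σ_xσ_y⟩_{θ, h=0}`. Proof: switch the ghost couplings on along
`t ↦ θ⁰ + t(θ - θ⁰)`; the truncated pair function decreases (GHS, `gksTrunc_affCpl_one_le`) and at
`t = 0` it is at most the pair function (GKS I). [cite: AizenmanFernandezJSP1986, §4.3, Prop. 4.7, eq. (4.22)] [cite: Lebowitz1974, eq. (1.8) and §2, Remark (ii)] -/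
theorem thetaCorr_pair_sub_mul_le_zeroField {θ : Sym2 (Option V) → ℝ} (hθ : ∀ e, 0 ≤ θ e) {x y : V}
    (hx : x ∈ Λ) (hy : y ∈ Λ) :
    thetaCorr G Λ θ ({x} ∆ {y}) - thetaCorr G Λ θ {x} * thetaCorr G Λ θ {y} ≤
      thetaCorr G Λ (zeroField θ) ({x} ∆ {y}) := by
  set K : Sym2 V ⊕ V → ℝ := thetaCpl G Λ (zeroField θ) with hK
  set W : Sym2 V ⊕ V → ℝ := fun i => thetaCpl G Λ θ i - K i with hW
  have hKW : affCpl K W 1 = thetaCpl G Λ θ := by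
    funext i; simp only [affCpl, hW]; ring
  have hK0 : ∀ i ∈ isingIdx G Λ, 0 ≤ K i := thetaCpl_nonneg (zeroField_nonneg hθ)
  have hWval : ∀ i, W i = Sum.elim (fun _ => (0 : ℝ)) (fun x => θ (ghostEdge x)) i := by
    rintro (e | z)
    · simp only [hW, hK, thetaCpl_zeroField, Sum.elim_inl, sub_self]
    · simp only [hW, hK, thetaCpl_zeroField, Sum.elim_inr, sub_zero, thetaCpl]
  have hW0 : ∀ i ∈ isingIdx G Λ, 0 ≤ W i := by
    rintro (e | z) _
    · rw [hWval]; exact le_rfl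
    · rw [hWval]; exact hθ _
  have hW1 : ∀ i ∈ isingIdx G Λ, W i ≠ 0 → ∃ z, isingSupp Λ i = {z} := by
    rintro (e | z) hi hne
    · rw [hWval] at hne; exact absurd rfl hne
    · have hz : z ∈ Λ := by
        rw [isingIdx, Finset.inr_mem_disjSum] at hi; exact hi
      exact ⟨⟨z, hz⟩, isingSupp_inr_eq_singleton hz⟩
  have hC : ∀ i ∈ isingIdx G Λ, (isingSupp Λ i).card ≤ 2 := fun i _ => card_isingSupp_le_two Λ i
  have key := gksTrunc_affCpl_one_le (isingIdx G Λ) K W (isingSupp Λ) hK0 hC hW0 hW1 ⟨x, hx⟩ ⟨y, hy⟩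
  rw [hKW] at key
  rw [thetaCorr_pair_eq_gksExpect θ hx hy, thetaCorr_singleton_eq_gksExpect θ hx,
    thetaCorr_singleton_eq_gksExpect θ hy, thetaCorr_pair_eq_gksExpect (zeroField θ) hx hy]
  refine key.trans ?_
  have h1 : 0 ≤ gksExpect (isingIdx G Λ) K (isingSupp Λ) (spinAt ⟨x, hx⟩) := by
    rw [← spinProduct_singleton]; exact gksExpect_spinProduct_nonneg _ _ _ hK0 _
  have h2 : 0 ≤ gksExpect (isingIdx G Λ) K (isingSupp Λ) (spinAt ⟨y, hy⟩) := by
    rw [← spinProduct_singleton]; exact gksExpect_spinProduct_nonneg _ _ _ hK0 _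
  nlinarith [mul_nonneg h1 h2]

/-- **The truncated pair function is dominated by the pair function of any larger zero-field
system**: for `0 ≤ θ`, `zeroField θ ≤ θ'`, `⟨σ_xσ_y⟩_θ - ⟨σ_x⟩_θ⟨σ_y⟩_θ ≤ ⟨σ_xσ_y⟩_{θ'}`
(the form used for depleted systems inside the full zero-field system, Aizenman–Fernández 1986,
(5.8): "`⟨σ_z;σ_k⟩_A ≤ ⟨σ_zσ_k⟩_{h=0}` … this bound is monotonic with the strength of the
interaction"). [cite: AizenmanFernandezJSP1986, §5.1, proof of Prop. 5.2, eq. (5.8)] -/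
theorem thetaCorr_pair_sub_mul_le_of_zeroField_le {θ θ' : Sym2 (Option V) → ℝ} (hθ : ∀ e, 0 ≤ θ e)
    (hle : ∀ e, zeroField θ e ≤ θ' e) {x y : V} (hx : x ∈ Λ) (hy : y ∈ Λ) :
    thetaCorr G Λ θ ({x} ∆ {y}) - thetaCorr G Λ θ {x} * thetaCorr G Λ θ {y} ≤ thetaCorr G Λ θ' ({x} ∆ {y}) :=
  (thetaCorr_pair_sub_mul_le_zeroField hθ hx hy).trans
    (thetaCorr_mono (zeroField_nonneg hθ) hle
      (symmDiff_le_sup.trans (sup_le (singleton_subset_iff.2 hx) (singleton_subset_iff.2 hy))))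

end Theta

end Literature.Probability.LatticeModels
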